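import Mathlib.LinearAlgebra.Matrix.GeneralLinearGroup.Defs
import Mathlib.Data.ZMod.Basic
import Mathlib.Algebra.Polynomial.AlgebraMap
import Mathlib.Tactic.Ring
import Mathlib.Tactic.NoncommRing
import HarnessLib

/-!
# X11b at `p = 3` (team N8/O2), S7 · IMG3b supplement 2 (r2's K4 (a) lifting remark): `−1` in the
# image modulo `3` lifts to `−1` in the image modulo `3^m` — `h ≡ −1 (mod 3) ⇒ h^{3^{m−1}} = −1`
# in `GL₂(ℤ/3^m)`

HONEST FRAMING (cell `b2b-bsdres`, run/shared/lean/b2b/bsd-rank1-residual/, verbatim in every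
file): the goal of the cell is to DELETE the COMBINATION-SHAPED residual classes of the
Birch–Swinnerton-Dyer formula for ALL analytic-rank `≤ 1` elliptic curves over `ℚ` — "full BSD
formula for every rank `≤ 1` curve in class `C`" assembled STRICTLY from published theorems — so
that the rank-`≤ 1` remainder becomes exactly the CONSTRUCTION-SHAPED classes, which are TYPED
(missing-input `Prop`s), NOT attempted. This is not "finishing BSD". Team N8/O2 = `x11b3` (X11b at
`p = 3`), seat `b2b-bsdres-x11b3-p1`; supplement to S7 (`ImageSah.lean`, `ImageNegOne.lean`)
recording route planner r2's remark K4 (a) (`cells/x11b3/LINE-K.md` ⟦r2⟧ block 1, INBOX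
2026-08-21T05:21:31Z). Pure algebra; nothing is booked; no label changes. THEOREMS ONLY (no
definition, no named fact, no `sorry`).

## What and why

Sah's lemma at level `3^m` (`ImageSah.lean`) wants `−1 ∈ G` for the image `G = ρ_{E,3^m}(G_K)`.
`ImageNegOne.lean` supplies it when `ρ_{E,3^m}` is onto `GL₂(ℤ/3^m)` (tower surjectivity). r2's
remark removes the tower hypothesis: it suffices that `−1` lies in the image MODULO `3` (which holds
for every index-`≤ 2` subgroup of `GL₂(𝔽₃)` — `ImageNegOne` at `m = 1`, i.e. from `Surj W 3`
alone, for every quadratic `K`): if `h ∈ GL₂(ℤ/3^m)` reduces to `−1` modulo `3` then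
`h^{3^{m−1}} = −1`. Indeed `h = −(1 − 3x)`, `(1 + 3y)^{3^j} ≡ 1 (mod 3^{j+1})` by induction
(`(1 + 3^{j+1}y)^3 = 1 + 3^{j+2}(y + 3^{j+1}y² + 3^{2j+1}y³)`), and `3^{m−1}` is odd.

* `one_add_three_mul_pow_three_pow` — in any ring: `(1 + 3x)^{3^j} = 1 + 3^{j+1} y` for some `y`
  (proved in `ℤ[X]` by induction and `ring`, transported by `Polynomial.aeval x`);
* `neg_one_add_three_mul_pow_eq_neg_one` — in a ring with `(3 : R)^m = 0`, `m ≥ 1`: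
  `(−1 + 3x)^{3^{m−1}} = −1`;
* `GL2.neg_one_mem_of_val_eq_neg_one_add` — for `H ≤ GL₂(ℤ/3^m)` (`m ≥ 1`): if some `h ∈ H` has
  matrix `−1 + 3X` then `−1 ∈ H` (namely `−1 = h^{3^{m−1}}`).

Dictionary (for S3 / K4, wired by their owners): `H = ρ_{E,3^m}(G_K)`; the hypothesis is
"`ρ̄_{E,3}(σ) = −1` for some `σ ∈ G_K`" (`ImageNegOne.GL2.neg_one_mem_of_index_dvd_two` at `m = 1`
under `Surj W 3`), read through the compatibility of the mod-`3^m` and mod-`3` frames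
(tree: `exists_map_eq_of_hasSurjectiveModNGaloisRep`-type reduction).

References: standard (`p`-adic binomial congruence); team file `cells/x11b3/LINE-K.md` ⟦r2⟧ block 1.
-/

namespace Summit.BirchSwinnertonDyer.Rank1Residual.X11b.Three

/-! ### The binomial congruence `(1 + 3x)^{3^j} ≡ 1 (mod 3^{j+1})` -/

section Ring

/-- Commutative case: `(1 + 3x)^{3^j} = 1 + 3^{j+1}·y` for some `y`. [folklore] -/
theorem one_add_three_mul_pow_three_pow_comm {S : Type*} [CommRing S] (x : S) (j : ℕ) :
    ∃ y : S, (1 + 3 * x) ^ 3 ^ j = 1 + 3 ^ (j + 1) * y := by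
  induction j with
  | zero => exact ⟨x, by simp⟩
  | succ j ih =>
    obtain ⟨y, hy⟩ := ih
    refine ⟨y + 3 ^ (j + 1) * y ^ 2 + 3 ^ (2 * j + 1) * y ^ 3, ?_⟩
    rw [pow_succ, pow_mul, hy]
    ring

variable {R : Type*} [Ring R]

/-- **`(1 + 3x)^{3^j} = 1 + 3^{j+1}·y`** in ANY ring (the identity lives in the commutative subring
`ℤ[x]`: transport from `ℤ[X]` along `Polynomial.aeval x`). [folklore] -/
theorem one_add_three_mul_pow_three_pow (x : R) (j : ℕ) :
    ∃ y : R, (1 + 3 * x) ^ 3 ^ j = 1 + 3 ^ (j + 1) * y := by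
  obtain ⟨Y, hY⟩ := one_add_three_mul_pow_three_pow_comm (Polynomial.X : Polynomial ℤ) j
  refine ⟨Polynomial.aeval x Y, ?_⟩
  have h := congrArg (Polynomial.aeval x) hY
  simpa [map_pow, map_add, map_mul, map_ofNat, Polynomial.aeval_X] using h

/-- **`(−1 + 3x)^{3^{m−1}} = −1` when `3^m = 0` in the ring** (`m ≥ 1`): `−1 + 3x = −(1 + 3(−x))`,
`3^{m−1}` is odd, and `(1 + 3(−x))^{3^{m−1}} = 1 + 3^m y = 1`. [folklore] -/
theorem neg_one_add_three_mul_pow_eq_neg_one {m : ℕ} (hm : 1 ≤ m) (h3 : (3 : R) ^ m = 0) (x : R) :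
    (-1 + 3 * x) ^ 3 ^ (m - 1) = -1 := by
  obtain ⟨y, hy⟩ := one_add_three_mul_pow_three_pow (-x) (m - 1)
  have hodd : Odd (3 ^ (m - 1)) := Odd.pow (by decide)
  have hneg : (-1 + 3 * x : R) = -(1 + 3 * -x) := by noncomm_ring
  rw [hneg, hodd.neg_pow, hy, Nat.sub_add_cancel hm, h3, zero_mul, add_zero]

end Ring

/-! ### `GL₂(ℤ/3^m)`: an element `≡ −1 (mod 3)` powers to `−1` -/

namespace GL2

/-- `3^m = 0` in the matrix ring over `ℤ/3^m`. [folklore] -/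
theorem three_pow_eq_zero_matrix (m : ℕ) :
    (3 : Matrix (Fin 2) (Fin 2) (ZMod (3 ^ m))) ^ m = 0 := by
  have h : ((3 ^ m : ℕ) : ZMod (3 ^ m)) = 0 := ZMod.natCast_self _
  have h' : ((3 ^ m : ℕ) : Matrix (Fin 2) (Fin 2) (ZMod (3 ^ m))) = 0 := by
    rw [← map_natCast (algebraMap (ZMod (3 ^ m)) (Matrix (Fin 2) (Fin 2) (ZMod (3 ^ m)))), h,
      map_zero]
  have : (3 : Matrix (Fin 2) (Fin 2) (ZMod (3 ^ m))) = ((3 : ℕ) : Matrix (Fin 2) (Fin 2) (ZMod (3 ^ m))) := by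
    norm_cast
  rw [this, ← Nat.cast_pow, h']

/-- **`−1 ∈ H` as soon as `H ≤ GL₂(ℤ/3^m)` contains an element `h ≡ −1 (mod 3)`** (`m ≥ 1`):
`h^{3^{m−1}} = −1`. Dictionary: `H = ρ_{E,3^m}(G_K)`, `h` any element reducing to `−1 ∈ ρ̄_{E,3}(G_K)`
(available from `Surj W 3` alone, `ImageNegOne` at `m = 1`). [folklore] -/
theorem neg_one_mem_of_val_eq_neg_one_add {m : ℕ} (hm : 1 ≤ m)
    (H : Subgroup (GL (Fin 2) (ZMod (3 ^ m)))) {h : GL (Fin 2) (ZMod (3 ^ m))} (hh : h ∈ H)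
    (X : Matrix (Fin 2) (Fin 2) (ZMod (3 ^ m)))
    (hX : (h : Matrix (Fin 2) (Fin 2) (ZMod (3 ^ m))) = -1 + 3 * X) :
    (-1 : GL (Fin 2) (ZMod (3 ^ m))) ∈ H := by
  have hpow : h ^ 3 ^ (m - 1) = -1 := by
    apply Units.ext
    rw [Units.val_pow_eq_pow_val, hX, Units.val_neg, Units.val_one]
    exact neg_one_add_three_mul_pow_eq_neg_one hm (three_pow_eq_zero_matrix m) X
  rw [← hpow]
  exact H.pow_mem hh _

/-- The same with the power made explicit: `h^{3^{m−1}} = −1` in `GL₂(ℤ/3^m)`. [folklore] -/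
theorem pow_three_pow_eq_neg_one {m : ℕ} (hm : 1 ≤ m) (h : GL (Fin 2) (ZMod (3 ^ m)))
    (X : Matrix (Fin 2) (Fin 2) (ZMod (3 ^ m)))
    (hX : (h : Matrix (Fin 2) (Fin 2) (ZMod (3 ^ m))) = -1 + 3 * X) :
    h ^ 3 ^ (m - 1) = -1 := by
  apply Units.ext
  rw [Units.val_pow_eq_pow_val, hX, Units.val_neg, Units.val_one]
  exact neg_one_add_three_mul_pow_eq_neg_one hm (three_pow_eq_zero_matrix m) X

end GL2

end Summit.BirchSwinnertonDyer.Rank1Residual.X11b.Three
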